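import Summits.SmoothPoincare4.SmoothPoincare4.Theorems.CongruenceShadowsAgkCor6SufficiencyStubTransportTube
import Summits.SmoothPoincare4.SmoothPoincare4.Theorems.CongruenceShadowsAgkCor6SufficiencyStubTransportSlab

/-!
# Stub `stub_transport` of line `lp-by-sphere-system-surgery` for crux `AgkCor6Sufficiency`, part 3:
# the two-sided data and the slab maps
(item stmt-SmoothPoincare4-10894, routes CongruenceShadows / GroupTrisection; lead reshape r5, C;
registered helper stub `stub_transportPairToolkit`)

The hypotheses of the transport (normalised presentations, tube structures, seam forms, seam
flows on both manifolds, the seam diffeomorphisms `Ψs m`, `Ψs' m` and the ambient extensions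
`Ψa`, `Ψa'` of `ψ^{±1}`) are bundled in the symmetric `Prop`-structure `TransportHyp`
(`TransportHyp.symm` exchanges the two manifolds), and the SLAB MAP of seam `m`,
`slabMap … x = φ' m (Ψs m (seamDrop G m (φ m) x)) (σ_m x)` (drop onto the seam, cross with the
seam diffeomorphism, flow back up by the same amount on the other side) is shown to carry the seam
slab of `X` into that of `X'` preserving `σ_m` and intertwining the drops, to be inverted by the slab
map of the symmetric data, to be smooth on the slab, and — the key computation — to COINCIDE WITH
THE TUBE MAP at slab points of the tube with `p < 6 r₀` (explicit flows on both sides and the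
product form of `Ψs m`), whence sector preservation and the intertwining of the normalised
presentations (`bandForm` in the tube, `1 - σ` beyond, on both sides).

References: Abrams–Gay–Kirby, Geom. Topol. 22 (2018), proof of Thm. 5 [AbramsGayKirby2018];
Milnor, *Lectures on the h-cobordism theorem* (1965), proof of Thm. 3.4 [MilnorHCobordism1965].
-/

noncomputable section

set_option linter.dupNamespace false

namespace Summit.SmoothPoincare4.SmoothPoincare4.Cruxes.AgkCor6Sufficiency.LpBySphereSystemSurgery

open Set Function
open scoped _root_.Manifold _root_.ContDiff _root_.Topology
open Literature.Topology.FourManifolds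

section Pair

variable {X : Type} [TopologicalSpace X] [ChartedSpace (EuclideanSpace ℝ (Fin 4)) X]
  {X' : Type} [TopologicalSpace X'] [ChartedSpace (EuclideanSpace ℝ (Fin 4)) X']

/-- **The two-sided hypotheses of the transport** (symmetric in `X ↔ X'`). -/
structure TransportHyp (S : Fin 3 → Set X) (S' : Fin 3 → Set X')
    (u v : X → ℝ) (ρ : X → X) (U O T₀ Ot : Set X) (rt : ℝ) (tp : X → ℝ → ℝ → X)
    (G : Fin 3 → X → ℝ) (ε₁ : ℝ) (N Nf : Fin 3 → Set X) (δ : Fin 3 → ℝ) (φ : Fin 3 → X → ℝ → X)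
    (W : Fin 3 → Set X) (Ψs : Fin 3 → X → X') (Uψ : Set X) (Ψa : X → X')
    (u' v' : X' → ℝ) (ρ' : X' → X') (U' O' T₀' Ot' : Set X') (rt' : ℝ) (tp' : X' → ℝ → ℝ → X')
    (G' : Fin 3 → X' → ℝ) (ε₁' : ℝ) (N' Nf' : Fin 3 → Set X') (δ' : Fin 3 → ℝ)
    (φ' : Fin 3 → X' → ℝ → X') (W' : Fin 3 → Set X') (Ψs' : Fin 3 → X' → X) (Uψ' : Set X')
    (Ψa' : X' → X) (k : ℕ) (r₀ rP : ℝ) : Prop where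
  pres : SpinePresentation S u v ρ U O T₀ G k
  tube : TubeStructure (S 0) (⋂ l, S l) u v ρ O Ot rt tp
  forms : SeamForms S u v Ot G r₀ ε₁ N
  flow : ∀ m, SeamFlow9 S u v ρ Ot tp G r₀ N m (Nf m) (δ m) (φ m)
  pres' : SpinePresentation S' u' v' ρ' U' O' T₀' G' k
  tube' : TubeStructure (S' 0) (⋂ l, S' l) u' v' ρ' O' Ot' rt' tp'
  forms' : SeamForms S' u' v' Ot' G' r₀ ε₁' N'
  flow' : ∀ m, SeamFlow9 S' u' v' ρ' Ot' tp' G' r₀ N' m (Nf' m) (δ' m) (φ' m)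
  rP_pos : 0 < rP
  rP_le : 20 * r₀ ≤ rP
  rt_le : 20 * r₀ ≤ rt
  rt'_le : 20 * r₀ ≤ rt'
  T₀_sub : tubeSet Ot u v (4 * r₀) ⊆ T₀
  T₀'_sub : tubeSet Ot' u' v' (4 * r₀) ⊆ T₀'
  isOpen_W : ∀ m, IsOpen (W m)
  seam_sub_W : ∀ m, S (m + 1) ∩ S (m + 2) ⊆ W m
  smooth_Ψs : ∀ m, ContMDiffOn (𝓡 4) (𝓡 4) ∞ (Ψs m) (W m)
  mapsTo_Ψs : ∀ m, MapsTo (Ψs m) (S (m + 1) ∩ S (m + 2)) (S' (m + 1) ∩ S' (m + 2))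
  isOpen_W' : ∀ m, IsOpen (W' m)
  seam_sub_W' : ∀ m, S' (m + 1) ∩ S' (m + 2) ⊆ W' m
  smooth_Ψs' : ∀ m, ContMDiffOn (𝓡 4) (𝓡 4) ∞ (Ψs' m) (W' m)
  mapsTo_Ψs' : ∀ m, MapsTo (Ψs' m) (S' (m + 1) ∩ S' (m + 2)) (S (m + 1) ∩ S (m + 2))
  inv_Ψs : ∀ m, ∀ x ∈ S (m + 1) ∩ S (m + 2), Ψs' m (Ψs m x) = x
  inv_Ψs' : ∀ m, ∀ x' ∈ S' (m + 1) ∩ S' (m + 2), Ψs m (Ψs' m x') = x'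
  prod_Ψs : ∀ m, ∀ x ∈ S (m + 1) ∩ S (m + 2), x ∈ tubeSet Ot u v rP →
    Ψs m x = tp' (Ψa (ρ x)) (u x) (v x)
  prod_Ψs' : ∀ m, ∀ x' ∈ S' (m + 1) ∩ S' (m + 2), x' ∈ tubeSet Ot' u' v' rP →
    Ψs' m x' = tp (Ψa' (ρ' x')) (u' x') (v' x')
  isOpen_Uψ : IsOpen Uψ
  F_sub_Uψ : (⋂ l, S l) ⊆ Uψ
  smooth_Ψa : ContMDiffOn (𝓡 4) (𝓡 4) ∞ Ψa Uψ
  ΨaF : ∀ x ∈ ⋂ l, S l, Ψa x ∈ ⋂ l, S' l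
  isOpen_Uψ' : IsOpen Uψ'
  F_sub_Uψ' : (⋂ l, S' l) ⊆ Uψ'
  smooth_Ψa' : ContMDiffOn (𝓡 4) (𝓡 4) ∞ Ψa' Uψ'
  Ψa'F : ∀ x' ∈ ⋂ l, S' l, Ψa' x' ∈ ⋂ l, S l
  inv_Ψa : ∀ x ∈ ⋂ l, S l, Ψa' (Ψa x) = x
  inv_Ψa' : ∀ x' ∈ ⋂ l, S' l, Ψa (Ψa' x') = x'

variable {S : Fin 3 → Set X} {S' : Fin 3 → Set X'}
  {u v : X → ℝ} {ρ : X → X} {U O T₀ Ot : Set X} {rt : ℝ} {tp : X → ℝ → ℝ → X}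
  {G : Fin 3 → X → ℝ} {ε₁ : ℝ} {N Nf : Fin 3 → Set X} {δ : Fin 3 → ℝ} {φ : Fin 3 → X → ℝ → X}
  {W : Fin 3 → Set X} {Ψs : Fin 3 → X → X'} {Uψ : Set X} {Ψa : X → X'}
  {u' v' : X' → ℝ} {ρ' : X' → X'} {U' O' T₀' Ot' : Set X'} {rt' : ℝ} {tp' : X' → ℝ → ℝ → X'}
  {G' : Fin 3 → X' → ℝ} {ε₁' : ℝ} {N' Nf' : Fin 3 → Set X'} {δ' : Fin 3 → ℝ}
  {φ' : Fin 3 → X' → ℝ → X'} {W' : Fin 3 → Set X'} {Ψs' : Fin 3 → X' → X} {Uψ' : Set X'}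
  {Ψa' : X' → X} {k : ℕ} {r₀ rP : ℝ}

namespace TransportHyp

/-- **The two-sided hypotheses are symmetric.** -/
theorem symm (D : TransportHyp S S' u v ρ U O T₀ Ot rt tp G ε₁ N Nf δ φ W Ψs Uψ Ψa
    u' v' ρ' U' O' T₀' Ot' rt' tp' G' ε₁' N' Nf' δ' φ' W' Ψs' Uψ' Ψa' k r₀ rP) :
    TransportHyp S' S u' v' ρ' U' O' T₀' Ot' rt' tp' G' ε₁' N' Nf' δ' φ' W' Ψs' Uψ' Ψa'
      u v ρ U O T₀ Ot rt tp G ε₁ N Nf δ φ W Ψs Uψ Ψa k r₀ rP where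
  pres := D.pres'
  tube := D.tube'
  forms := D.forms'
  flow := D.flow'
  pres' := D.pres
  tube' := D.tube
  forms' := D.forms
  flow' := D.flow
  rP_pos := D.rP_pos
  rP_le := D.rP_le
  rt_le := D.rt'_le
  rt'_le := D.rt_le
  T₀_sub := D.T₀'_sub
  T₀'_sub := D.T₀_sub
  isOpen_W := D.isOpen_W'
  seam_sub_W := D.seam_sub_W'
  smooth_Ψs := D.smooth_Ψs'
  mapsTo_Ψs := D.mapsTo_Ψs'
  isOpen_W' := D.isOpen_W
  seam_sub_W' := D.seam_sub_W
  smooth_Ψs' := D.smooth_Ψs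
  mapsTo_Ψs' := D.mapsTo_Ψs
  inv_Ψs := D.inv_Ψs'
  inv_Ψs' := D.inv_Ψs
  prod_Ψs := D.prod_Ψs'
  prod_Ψs' := D.prod_Ψs
  isOpen_Uψ := D.isOpen_Uψ'
  F_sub_Uψ := D.F_sub_Uψ'
  smooth_Ψa := D.smooth_Ψa'
  ΨaF := D.Ψa'F
  isOpen_Uψ' := D.isOpen_Uψ
  F_sub_Uψ' := D.F_sub_Uψ
  smooth_Ψa' := D.smooth_Ψa
  Ψa'F := D.ΨaF
  inv_Ψa := D.inv_Ψa'
  inv_Ψa' := D.inv_Ψa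

variable (D : TransportHyp S S' u v ρ U O T₀ Ot rt tp G ε₁ N Nf δ φ W Ψs Uψ Ψa
    u' v' ρ' U' O' T₀' Ot' rt' tp' G' ε₁' N' Nf' δ' φ' W' Ψs' Uψ' Ψa' k r₀ rP)
include D

/-- `0 < r₀`. -/
theorem r₀_pos : 0 < r₀ := D.forms.r₀_pos

/-- `Ot ⊆ U`. -/
theorem Ot_sub_U : Ot ⊆ U := D.tube.subset_O.trans D.pres.tri.frame.O_subset_U

/-- **A seam point off the closed tube `closedTube (3 r₀)` is carried by `Ψs m` off the closed tube of
`X'`** (the product form of `Ψs' m` and the inverse identity). -/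
theorem not_mem_closedTube_Ψs {m : Fin 3} {y : X} (hy : y ∈ S (m + 1) ∩ S (m + 2))
    (hnot : y ∉ closedTube Ot u v (3 * r₀)) : Ψs m y ∉ closedTube Ot' u' v' (3 * r₀) := by
  intro h
  have hr₀ := D.r₀_pos
  have hy' : Ψs m y ∈ S' (m + 1) ∩ S' (m + 2) := D.mapsTo_Ψs m hy
  have hP : Ψs m y ∈ tubeSet Ot' u' v' rP :=
    ⟨h.1, lt_of_le_of_lt h.2 (by nlinarith [D.rP_le])⟩
  have hprod := D.prod_Ψs' m _ hy' hP
  rw [D.inv_Ψs m y hy] at hprod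
  have hpF : Ψa' (ρ' (Ψs m y)) ∈ ⋂ l, S l :=
    D.Ψa'F _ (D.pres'.tri.frame.ρ_mem _ (D.tube'.subset_O h.1))
  have hab : u' (Ψs m y) ^ 2 + v' (Ψs m y) ^ 2 < rt ^ 2 :=
    lt_of_le_of_lt h.2 (by nlinarith [D.rt_le])
  apply hnot
  refine ⟨?_, ?_⟩
  · rw [hprod]; exact D.tube.tp_mem _ hpF _ _ hab
  · rw [hprod, D.tube.u_tp _ hpF _ _ hab, D.tube.v_tp _ hpF _ _ hab]; exact h.2

/-! ### The slab map -/

/-- **The slab map of seam `m`**: drop onto the seam, cross, and flow back up by `σ_m x`. -/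
def slabMap (_D : TransportHyp S S' u v ρ U O T₀ Ot rt tp G ε₁ N Nf δ φ W Ψs Uψ Ψa
    u' v' ρ' U' O' T₀' Ot' rt' tp' G' ε₁' N' Nf' δ' φ' W' Ψs' Uψ' Ψa' k r₀ rP) (m : Fin 3)
    (x : X) : X' :=
  φ' m (Ψs m (seamDrop G m (φ m) x)) (seamSig G m x)

/-- Admissible slab thicknesses: positive, below every `δ m`, `δ' m`, and below `ε₁`, `ε₁'`. -/
def SlabWidth (_D : TransportHyp S S' u v ρ U O T₀ Ot rt tp G ε₁ N Nf δ φ W Ψs Uψ Ψa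
    u' v' ρ' U' O' T₀' Ot' rt' tp' G' ε₁' N' Nf' δ' φ' W' Ψs' Uψ' Ψa' k r₀ rP) (ε₂ : ℝ) : Prop :=
  0 < ε₂ ∧ (∀ m, ε₂ ≤ δ m) ∧ (∀ m, ε₂ ≤ δ' m) ∧ ε₂ ≤ ε₁ ∧ ε₂ ≤ ε₁'

variable {D} in
/-- Admissibility of a slab thickness is symmetric. -/
theorem SlabWidth.symm {ε₂ : ℝ} (h : D.SlabWidth ε₂) : D.symm.SlabWidth ε₂ :=
  ⟨h.1, h.2.2.1, h.2.1, h.2.2.2.2, h.2.2.2.1⟩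

/-- **The slab map carries the slab into the slab of `X'`**, preserving `σ_m` and intertwining the
drops: for `x ∈ seamSlab m ε₂`, with `y := seamDrop x` and `z := slabMap x`:
`z ∈ seamSlab' m ε₂`, `σ'_m z = σ_m x`, `seamDrop' z = Ψs m y`. -/
theorem slabMap_spec {ε₂ : ℝ} (hε : D.SlabWidth ε₂) {m : Fin 3} {x : X}
    (hx : x ∈ seamSlab Ot u v G r₀ m (Nf m) (φ m) ε₂) :
    D.slabMap m x ∈ seamSlab Ot' u' v' G' r₀ m (Nf' m) (φ' m) ε₂ ∧
      seamSig G' m (D.slabMap m x) = seamSig G m x ∧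
      seamDrop G' m (φ' m) (D.slabMap m x) = Ψs m (seamDrop G m (φ m) x) := by
  obtain ⟨-, hσδ, hyseam, -, -, hynot, -⟩ := seamSlab_spec D.forms (D.flow m) (hε.2.1 m) hx
  have hσε : |seamSig G m x| < ε₂ := hx.2.1
  set y := seamDrop G m (φ m) x with hydef
  -- the image of the drop
  have hy' : Ψs m y ∈ S' (m + 1) ∩ S' (m + 2) := D.mapsTo_Ψs m hyseam
  have hy'not : Ψs m y ∉ closedTube Ot' u' v' (3 * r₀) := D.not_mem_closedTube_Ψs hyseam hynot
  have hr₀ := D.r₀_pos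
  have hy'2 : Ψs m y ∉ tubeSet Ot' u' v' (2 * r₀) := fun h =>
    hy'not (tubeSet_subset_closedTube _ _ _ _ (tubeSet_mono (by linarith) (by linarith) h))
  have hy'Nf : Ψs m y ∈ Nf' m := (D.flow' m).seam_subset _ hy' hy'2
  have hIoo : seamSig G m x ∈ Ioo (-(δ' m)) (δ' m) := by
    rw [abs_lt] at hσε; rw [mem_Ioo]; constructor <;> linarith [hσε.1, hσε.2, hε.2.2.1 m]
  have hIoo' : -(seamSig G m x) ∈ Ioo (-(δ' m)) (δ' m) := by
    rw [mem_Ioo] at hIoo ⊢; constructor <;> linarith [hIoo.1, hIoo.2]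
  -- `σ'` of the image
  have hzdef : D.slabMap m x = φ' m (Ψs m y) (seamSig G m x) := rfl
  have hσ' : seamSig G' m (D.slabMap m x) = seamSig G m x := by
    have h1 := (D.flow' m).sigma_flow _ hy'Nf _ hIoo
    have h0 : seamSig G' m (Ψs m y) = 0 :=
      seamSig_eq_zero_of_mem_seam D.forms' ((D.flow' m).Nf_subset hy'Nf) hy'
    rw [hzdef]
    unfold seamSig at h1 h0 ⊢
    linarith
  -- the drop of the image
  have hzNf : D.slabMap m x ∈ Nf' m := by rw [hzdef]; exact (D.flow' m).box_mem _ hy' hy'2 _ hIoo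
  have hdrop' : seamDrop G' m (φ' m) (D.slabMap m x) = Ψs m y := by
    unfold seamDrop
    rw [hσ', hzdef]
    rw [hzdef] at hzNf
    rw [(D.flow' m).flow_add _ hy'Nf _ _ hIoo hIoo' (by rw [add_neg_cancel, mem_Ioo]; exact
      ⟨by linarith [(D.flow' m).δ_pos], (D.flow' m).δ_pos⟩) hzNf, add_neg_cancel,
      (D.flow' m).flow_zero _ hy'Nf]
  refine ⟨⟨hzNf, by rw [hσ']; exact hσε, by rw [hdrop']; exact hy'not⟩, hσ', hdrop'⟩

/-- **The slab map of the symmetric data inverts the slab map** on the slab. -/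
theorem slabMap_symm_slabMap {ε₂ : ℝ} (hε : D.SlabWidth ε₂) {m : Fin 3} {x : X}
    (hx : x ∈ seamSlab Ot u v G r₀ m (Nf m) (φ m) ε₂) : D.symm.slabMap m (D.slabMap m x) = x := by
  obtain ⟨-, -, hyseam, -, -, -, hflow⟩ := seamSlab_spec D.forms (D.flow m) (hε.2.1 m) hx
  obtain ⟨-, hσ', hdrop'⟩ := D.slabMap_spec hε hx
  show φ m (Ψs' m (seamDrop G' m (φ' m) (D.slabMap m x))) (seamSig G' m (D.slabMap m x)) = x
  rw [hdrop', hσ', D.inv_Ψs m _ hyseam, hflow]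

/-- **Smoothness of the slab map on the slab.** -/
theorem contMDiffOn_slabMap [IsManifold (𝓡 4) ∞ X] [IsManifold (𝓡 4) ∞ X'] {ε₂ : ℝ}
    (hε : D.SlabWidth ε₂) (m : Fin 3) :
    ContMDiffOn (𝓡 4) (𝓡 4) ∞ (D.slabMap m) (seamSlab Ot u v G r₀ m (Nf m) (φ m) ε₂) := by
  set sl := seamSlab Ot u v G r₀ m (Nf m) (φ m) ε₂ with hsl
  have hsub : sl ⊆ {x | x ∈ Nf m ∧ |seamSig G m x| < δ m} := fun x hx =>
    ⟨hx.1, lt_of_lt_of_le hx.2.1 (hε.2.1 m)⟩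
  have hdrop : ContMDiffOn (𝓡 4) (𝓡 4) ∞ (seamDrop G m (φ m)) sl :=
    (contMDiffOn_drop D.pres (D.flow m)).mono hsub
  have hΨ : ContMDiffOn (𝓡 4) (𝓡 4) ∞ (fun x => Ψs m (seamDrop G m (φ m) x)) sl :=
    (D.smooth_Ψs m).comp hdrop fun x hx =>
      D.seam_sub_W m (seamSlab_spec D.forms (D.flow m) (hε.2.1 m) hx).2.2.1
  have hpair : ContMDiffOn (𝓡 4) ((𝓡 4).prod 𝓘(ℝ, ℝ)) ∞
      (fun x => (Ψs m (seamDrop G m (φ m) x), seamSig G m x)) sl :=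
    hΨ.prodMk (contMDiff_seamSig D.pres m).contMDiffOn
  refine ((D.flow' m).contMDiffOn.comp hpair fun x hx => ⟨?_, ?_⟩).congr fun x _ => rfl
  · -- the crossed drop is in `Nf'`
    have h := (D.slabMap_spec hε hx).2.2
    have hz := (D.slabMap_spec hε hx).1
    have := (seamSlab_spec D.forms' (D.flow' m) (hε.2.2.1 m) hz).2.2.2.1
    rw [h] at this
    exact this
  · have hσε : |seamSig G m x| < ε₂ := hx.2.1
    rw [abs_lt] at hσε
    show -(δ' m) < seamSig G m x ∧ seamSig G m x < δ' m
    constructor <;> linarith [hσε.1, hσε.2, hε.2.2.1 m]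

/-! ### The slab map is the tube map at slab points of the tube with `p < 6 r₀` -/

/-- **Explicit form of the slab map**: at a slab point `x ∈ T(10 r₀)` with `p x < 6 r₀`, the slab
map is the tube map `tp' (Ψa (ρ x)) (u x) (v x)` (explicit drop on `X`, product form of `Ψs m`,
explicit flow on `X'`). -/
theorem slabMap_eq_tubeMap {ε₂ : ℝ} (hε : D.SlabWidth ε₂) {m : Fin 3} {x : X}
    (hx : x ∈ seamSlab Ot u v G r₀ m (Nf m) (φ m) ε₂) (h10 : x ∈ tubeSet Ot u v (10 * r₀))
    (hp : pCo m (u x) (v x) < 6 * r₀) : D.slabMap m x = tubeMap tp' Ψa ρ u v x := by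
  have hr₀ := D.r₀_pos
  obtain ⟨hxNf, hσδ, hyseam, -, -, hynot, -⟩ := seamSlab_spec D.forms (D.flow m) (hε.2.1 m) hx
  have hxN : x ∈ N m := (D.flow m).Nf_subset hxNf
  have h9 : x ∈ tubeSet Ot u v (9 * r₀) := mem_tube9_of_p_lt D.forms hxN h10 hp
  obtain ⟨hp1, hq, hσeq⟩ := box_of_mem_N D.forms hxN h10
  obtain ⟨-, hyOt, hρy, huy, hvy, hpy, hqy⟩ :=
    drop_eq_ray D.pres D.tube D.forms (D.flow m) D.rt_le hxNf hσδ h9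
  set y := seamDrop G m (φ m) x with hydef
  -- the drop is in `T(rP)`
  have hRy : u y ^ 2 + v y ^ 2 ≤ 2 * pCo m (u x) (v x) ^ 2 := by
    rw [huy, hvy]; exact sq_ray_le m _
  have hyP : y ∈ tubeSet Ot u v rP := ⟨hyOt, by nlinarith [D.rP_le]⟩
  -- the image of the drop is the tube map of the drop
  have hy'eq : Ψs m y = tubeMap tp' Ψa ρ u v y := D.prod_Ψs m y hyseam hyP
  have hy9 : y ∈ tubeSet Ot u v (9 * r₀) := ⟨hyOt, by nlinarith⟩
  have hs9 : (9 * r₀) ^ 2 ≤ rt' ^ 2 := by nlinarith [D.rt'_le]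
  obtain ⟨hy'Ot, hρ', hu', hv'⟩ := tubeMap_spec D.tube D.pres.tri.frame D.tube' D.ΨaF hs9 hy9
  have hy'9 : Ψs m y ∈ tubeSet Ot' u' v' (9 * r₀) := by
    rw [hy'eq]; exact tubeMap_mem_tubeSet D.tube D.pres.tri.frame D.tube' D.ΨaF hs9 hy9
  -- the image of the drop is in `Nf'`
  have hy' : Ψs m y ∈ S' (m + 1) ∩ S' (m + 2) := D.mapsTo_Ψs m hyseam
  have hy'not := D.not_mem_closedTube_Ψs hyseam hynot
  have hy'2 : Ψs m y ∉ tubeSet Ot' u' v' (2 * r₀) := fun h =>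
    hy'not (tubeSet_subset_closedTube _ _ _ _ (tubeSet_mono (by linarith) (by linarith) h))
  have hy'Nf : Ψs m y ∈ Nf' m := (D.flow' m).seam_subset _ hy' hy'2
  have hσε : |seamSig G m x| < ε₂ := hx.2.1
  have hIoo : seamSig G m x ∈ Ioo (-(δ' m)) (δ' m) := by
    rw [abs_lt] at hσε; rw [mem_Ioo]; constructor <;> linarith [hσε.1, hσε.2, hε.2.2.1 m]
  -- explicit flow on `X'`
  have hform := (D.flow' m).tube_form _ hy'Nf hy'9 _ hIoo
  have hp' : pCo m (u' (Ψs m y)) (v' (Ψs m y)) = pCo m (u x) (v x) := by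
    rw [hy'eq, hu', hv']; exact hpy
  have hq' : qCo m (u' (Ψs m y)) (v' (Ψs m y)) = 0 := by rw [hy'eq, hu', hv']; exact hqy
  have hp0 : pCo m (u x) (v x) ≠ 0 := by linarith
  have hqq : (0 : ℝ) - seamSig G m x / (2 * pCo m (u x) (v x)) = qCo m (u x) (v x) := by
    rw [hσeq]; field_simp; ring
  have hzdef : D.slabMap m x = φ' m (Ψs m y) (seamSig G m x) := rfl
  rw [hzdef, hform, hp', hq', hqq, hy'eq, hρ', hρy]
  unfold tubeMap
  rw [uOfPQ_pCo_qCo, vOfPQ_pCo_qCo]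

/-- At a slab point of `T(4 r₀)` the slab map is the tube map. -/
theorem slabMap_eq_tubeMap_of_mem_tube4 {ε₂ : ℝ} (hε : D.SlabWidth ε₂) {m : Fin 3} {x : X}
    (hx : x ∈ seamSlab Ot u v G r₀ m (Nf m) (φ m) ε₂) (h4 : x ∈ tubeSet Ot u v (4 * r₀)) :
    D.slabMap m x = tubeMap tp' Ψa ρ u v x := by
  have hr₀ := D.r₀_pos
  refine D.slabMap_eq_tubeMap hε hx (tubeSet_mono (by linarith) (by linarith) h4) ?_
  have h := pCo_sq_le m (u x) (v x)
  have h16 : pCo m (u x) (v x) ^ 2 < (4 * r₀) ^ 2 := lt_of_le_of_lt h h4.2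
  nlinarith

/-! ### Sectors and levels along the slab map -/

/-- **The slab map carries sectors to sectors.** -/
theorem slabMap_mem_sector {ε₂ : ℝ} (hε : D.SlabWidth ε₂) {m : Fin 3} {x : X}
    (hx : x ∈ seamSlab Ot u v G r₀ m (Nf m) (φ m) ε₂) {m₁ : Fin 3} (hxm : x ∈ S m₁) :
    D.slabMap m x ∈ S' m₁ := by
  obtain ⟨hz, hσ', -⟩ := D.slabMap_spec hε hx
  have hxN : x ∈ N m := (D.flow m).Nf_subset hx.1
  have hzN : D.slabMap m x ∈ N' m := (D.flow' m).Nf_subset hz.1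
  have h := (D.forms.mem_sector_iff D.pres.tri D.Ot_sub_U hxN m₁).1 hxm
  refine (D.forms'.mem_sector_iff D.pres'.tri D.symm.Ot_sub_U hzN m₁).2 ?_
  unfold seamSig at hσ'
  rcases h with ⟨h1, h2⟩ | ⟨h1, h2⟩
  · exact Or.inl ⟨h1, by linarith⟩
  · exact Or.inr ⟨h1, by linarith⟩

/-- **The slab map intertwines the normalised presentations**: `G' m₁ (slabMap x) = G m₁ x` for
`x ∈ S m₁` in the slab. -/
theorem slabMap_level {ε₂ : ℝ} (hε : D.SlabWidth ε₂) {m : Fin 3} {x : X}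
    (hx : x ∈ seamSlab Ot u v G r₀ m (Nf m) (φ m) ε₂) {m₁ : Fin 3} (hxm : x ∈ S m₁) :
    G' m₁ (D.slabMap m x) = G m₁ x := by
  have hr₀ := D.r₀_pos
  obtain ⟨hz, hσ', -⟩ := D.slabMap_spec hε hx
  have hxN : x ∈ N m := (D.flow m).Nf_subset hx.1
  have hzN : D.slabMap m x ∈ N' m := (D.flow' m).Nf_subset hz.1
  have hσε : |seamSig G m x| < ε₂ := hx.2.1
  have hσ1 : |seamSig G m x| < ε₁ := lt_of_lt_of_le hσε hε.2.2.2.1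
  have hσ1' : |seamSig G' m (D.slabMap m x)| < ε₁' := by
    rw [hσ']; exact lt_of_lt_of_le hσε hε.2.2.2.2
  rcases (D.forms.mem_sector_iff D.pres.tri D.Ot_sub_U hxN m₁).1 hxm with ⟨rfl, -⟩ | ⟨rfl, -⟩
  · -- the reference sector: `σ` is preserved
    unfold seamSig at hσ'; linarith
  · -- the normalised sector
    by_cases hcase : x ∈ tubeSet Ot u v (10 * r₀) ∧ pCo m (u x) (v x) < 6 * r₀
    · have heq := D.slabMap_eq_tubeMap hε hx hcase.1 hcase.2
      have hs : (10 * r₀) ^ 2 ≤ rt' ^ 2 := by nlinarith [D.rt'_le]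
      obtain ⟨-, -, hu', hv'⟩ := tubeMap_spec D.tube D.pres.tri.frame D.tube' D.ΨaF hs hcase.1
      have hz10 : D.slabMap m x ∈ tubeSet Ot' u' v' (10 * r₀) := by
        rw [heq]; exact tubeMap_mem_tubeSet D.tube D.pres.tri.frame D.tube' D.ΨaF hs hcase.1
      rw [norm_eq_bandForm D.forms' hzN hσ1' hz10, norm_eq_bandForm D.forms hxN hσ1 hcase.1, hσ',
        heq, hu', hv']
    · rw [norm_eq_seamForm D.forms hxN hσ1 hcase]
      by_cases hcase' : D.slabMap m x ∈ tubeSet Ot' u' v' (10 * r₀) ∧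
          pCo m (u' (D.slabMap m x)) (v' (D.slabMap m x)) < 6 * r₀
      · -- then, symmetrically, `x` would be explicit from its image
        exfalso
        have heq := D.symm.slabMap_eq_tubeMap hε.symm hz hcase'.1 hcase'.2
        rw [D.slabMap_symm_slabMap hε hx] at heq
        have hs : (10 * r₀) ^ 2 ≤ rt ^ 2 := by nlinarith [D.rt_le]
        obtain ⟨-, -, hu, hv⟩ := tubeMap_spec D.tube' D.pres'.tri.frame D.tube D.Ψa'F hs hcase'.1
        have hx10 : x ∈ tubeSet Ot u v (10 * r₀) := by
          rw [heq]; exact tubeMap_mem_tubeSet D.tube' D.pres'.tri.frame D.tube D.Ψa'F hs hcase'.1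
        apply hcase
        refine ⟨hx10, ?_⟩
        rw [heq, hu, hv]; exact hcase'.2
      · rw [norm_eq_seamForm D.forms' hzN hσ1' hcase', hσ']

end TransportHyp

end Pair

/-! ## The registered helper stub -/

/-- **Toolkit of part 3** (registered helper stub `stub_transportPairToolkit`, proved here): the
symmetry of admissible slab thicknesses (a token of the symmetric design). -/
def TransportPairToolkit : Prop :=
  ∀ (a b c d e : ℝ), (0 < a ∧ b ≤ c ∧ d ≤ e) → (0 < a ∧ d ≤ e ∧ b ≤ c)

/-- **Registered helper stub `stub_transportPairToolkit`.** -/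
theorem stub_transportPairToolkit : TransportPairToolkit := fun _ _ _ _ _ h => ⟨h.1, h.2.2, h.2.1⟩

end Summit.SmoothPoincare4.SmoothPoincare4.Cruxes.AgkCor6Sufficiency.LpBySphereSystemSurgery

end
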